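import Summits.HubbardSuperconductivity.HubbardSuperconductivity.Theorems.JosephsonMirrorPositiveMinimiser
import Summits.HubbardSuperconductivity.HubbardSuperconductivity.Theorems.JosephsonMirrorFeynmanHellmann
import Literature.MathematicalPhysics.QuantumLattice.DWaveSourceProofs
import Literature.MathematicalPhysics.QuantumLattice.HubbardLSMFillingProofs

/-!
# Route `JosephsonMirror` — gain ⇒ zero-excess pair order (`HypGivesZEPO`)

Helper file for the crux stmt-HubbardSuperconductivity-2227 (`JmInterchange`) of route
`JosephsonMirror` (sub-problem `HubbardSuperconductivity`), line `Sketch`, stub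
`stub_hypGivesZEPO_of`: the INSTANTIATION of the two abstract lemmas `windowPigeonhole`
(`Theorems/JosephsonMirrorJmInterchangeWindowPigeonhole`) and `couplingExpectBound`
(`Theorems/JosephsonMirrorJmInterchangeCouplingBound`) on the Josephson window double
`H_L(J) = A ⊗ 1 + 1 ⊗ Aᵀ - J (D ⊗ D̄ + Dᴴ ⊗ D̄ᴴ)` (`A = hubbardTorusWith 2 L 1 U μ_L`,
`D = L⁻¹ Δ_d`, window `S_L = (N_L, N_L) ⊕ (N_L - 2, N_L - 2)` at `S^z = 0`).

Uniform linear Josephson gain `a J L² ≤ E_L(0) - E_L(J)` (`J ∈ (0, J₀]`, large even `L`) gives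
ZERO-EXCESS PAIR ORDER in one layer: for every `ε > 0`, eventually in even `L`, a unit vector `v`
of sector `N_L` or `N_L - 2` (`S^z = 0`) with `Re ⟨v, H v⟩ ≤ e_L(n) + ε L²` and
`‖Δ_d v‖² ≥ (a² / 8C²) L⁴` (`C L²` the a-priori bound `norm_pairField_le` on `‖Δ_d‖`).
Ingredients: the PSD minimiser `jmPositiveMinimiser_proof`, the Feynman–Hellmann bound
`sub_le_of_isMinimiser`, the trial state `φ ⊗ φ̄` of a sector ground state (`E_L(0) ≤ 2e₀`),
the block Rayleigh floors `block_rayleigh_lower`, and the two abstract lemmas (taken as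
hypotheses, in the registered shape of the stub).

Sources: T. Koma, H. Tasaki, J. Stat. Phys. 76 (1994) 745; E. H. Lieb, Phys. Rev. Lett. 62 (1989)
1201. All statements are folklore finite-dimensional linear algebra. No new definitions.
-/

-- the mandated namespace `Summit.<Summit>.<Problem>.Theorems` repeats `HubbardSuperconductivity`
-- (single-problem summit, D-0017), which the `dupNamespace` linter flags on every declaration
set_option linter.dupNamespace false

namespace Summit.HubbardSuperconductivity.HubbardSuperconductivity.Theorems.JosephsonMirror

open Matrix Literature.MathematicalPhysics.QuantumLattice
open scoped Kronecker ComplexOrder Matrix.Norms.L2Operator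

section Abstract

variable {ι : Type*} [Fintype ι] [DecidableEq ι]

/-- One-layer operator-norm bound `‖X v‖² ≤ ‖X‖² ‖v‖²` (`ℓ²` operator norm), in `Re ⟨·,·⟩`
form. [folklore] -/
theorem re_star_mulVec_self_le_opNorm_sq (X : Matrix ι ι ℂ) (v : ι → ℂ) :
    (star (X *ᵥ v) ⬝ᵥ (X *ᵥ v)).re ≤ ‖X‖ ^ 2 * (star v ⬝ᵥ v).re := by
  rw [star_mulVec, ← dotProduct_mulVec, mulVec_mulVec, sq,
    ← Matrix.l2_opNorm_conjTranspose_mul_self]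
  exact (le_abs_self _).trans (Matrix.abs_re_star_dotProduct_mulVec_le _ _)

omit [DecidableEq ι] in
/-- Scaling: `‖(c X) v‖² = |c|² ‖X v‖²`, in `Re ⟨·,·⟩` form. [folklore] -/
theorem re_star_smul_mulVec_dotProduct (c : ℂ) (X : Matrix ι ι ℂ) (v : ι → ℂ) :
    (star ((c • X) *ᵥ v) ⬝ᵥ ((c • X) *ᵥ v)).re = ‖c‖ ^ 2 * (star (X *ᵥ v) ⬝ᵥ (X *ᵥ v)).re := by
  rw [smul_mulVec, star_smul, smul_dotProduct, dotProduct_smul, smul_smul, smul_eq_mul,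
    Complex.star_def, ← Complex.normSq_eq_conj_mul_self, Complex.re_ofReal_mul,
    Complex.normSq_eq_norm_sq]

/-- **The two inputs of the column pigeonhole from the gain.** For a unit minimiser `ψ ∈ S` of
the `J`-problem (`J > 0`) of the window double, the gain `g J ≤ E(0) - E(J)` and the
Feynman–Hellmann bound `E(0) - E(J) ≤ J Re ⟨ψ, K ψ⟩` give `g ≤ Re ⟨ψ, K ψ⟩`; and with the
a-priori coupling bound `Re ⟨ψ, K ψ⟩ ≤ 2M` and `E(0) ≤ B`:
`Re ⟨ψ, H₀ ψ⟩ = E(J) + J Re ⟨ψ, K ψ⟩ ≤ B + 2 J M`. Koma–Tasaki, J. Stat. Phys. 76 (1994) 745.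
[folklore] -/
theorem pigeonhole_inputs_of_gain {A : Matrix ι ι ℂ} (hA : A.IsHermitian) (D : Matrix ι ι ℂ)
    {J g M B : ℝ} (hJ : 0 < J) (hg : 0 ≤ g) (S : Submodule ℂ (ι × ι → ℂ)) {ψ : ι × ι → ℂ}
    (hψ : ψ ∈ S) (h1 : star ψ ⬝ᵥ ψ = 1)
    (hmin : (star ψ ⬝ᵥ (A ⊗ₖ (1 : Matrix ι ι ℂ) + (1 : Matrix ι ι ℂ) ⊗ₖ Aᵀ -
        (J : ℂ) • (D ⊗ₖ Dᴴᵀ + Dᴴ ⊗ₖ Dᵀ)) *ᵥ ψ).re =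
      (A ⊗ₖ (1 : Matrix ι ι ℂ) + (1 : Matrix ι ι ℂ) ⊗ₖ Aᵀ -
        (J : ℂ) • (D ⊗ₖ Dᴴᵀ + Dᴴ ⊗ₖ Dᵀ)).minEnergyOn S)
    (hgain : g * J ≤ (A ⊗ₖ (1 : Matrix ι ι ℂ) + (1 : Matrix ι ι ℂ) ⊗ₖ Aᵀ -
          ((0 : ℝ) : ℂ) • (D ⊗ₖ Dᴴᵀ + Dᴴ ⊗ₖ Dᵀ)).minEnergyOn S -
        (A ⊗ₖ (1 : Matrix ι ι ℂ) + (1 : Matrix ι ι ℂ) ⊗ₖ Aᵀ -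
          (J : ℂ) • (D ⊗ₖ Dᴴᵀ + Dᴴ ⊗ₖ Dᵀ)).minEnergyOn S)
    (hK : (star ψ ⬝ᵥ (D ⊗ₖ Dᴴᵀ + Dᴴ ⊗ₖ Dᵀ) *ᵥ ψ).re ≤ 2 * M * (star ψ ⬝ᵥ ψ).re)
    (hB : (A ⊗ₖ (1 : Matrix ι ι ℂ) + (1 : Matrix ι ι ℂ) ⊗ₖ Aᵀ -
          ((0 : ℝ) : ℂ) • (D ⊗ₖ Dᴴᵀ + Dᴴ ⊗ₖ Dᵀ)).minEnergyOn S ≤ B) :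
    (star ψ ⬝ᵥ (A ⊗ₖ (1 : Matrix ι ι ℂ) + (1 : Matrix ι ι ℂ) ⊗ₖ Aᵀ) *ᵥ ψ).re ≤ B + 2 * J * M ∧
      g ≤ (star ψ ⬝ᵥ (D ⊗ₖ Dᴴᵀ + Dᴴ ⊗ₖ Dᵀ) *ᵥ ψ).re := by
  have hFH := sub_le_of_isMinimiser hA D J S hψ h1 hmin
  rw [re_rayleigh_windowDouble] at hmin
  rw [h1, Complex.one_re, mul_one] at hK
  refine ⟨?_, le_of_mul_le_mul_left (by linarith) hJ⟩
  nlinarith [mul_le_mul_of_nonneg_left hK hJ.le, mul_nonneg hg hJ.le]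

/-- **The trial state `φ ⊗ φ̄`.** If `φ` is a unit `A`-eigenvector with (real) eigenvalue `e₀`,
supported in the block `P₁` (so that `φ ⊗ φ̄` lies in the window `S`), then `E(0) ≤ 2 e₀`
(variational principle for `A ⊗ 1 + 1 ⊗ Aᵀ`). Tasaki (2020) §2.1; Koma–Tasaki, J. Stat. Phys.
76 (1994) 745. [folklore] -/
theorem minEnergyOn_zero_le_of_eigen {A : Matrix ι ι ℂ} (hA : A.IsHermitian) (D : Matrix ι ι ℂ)
    (P₁ : ι → Prop) (good : ι × ι → Prop) (hgood₁ : ∀ s t, P₁ s → P₁ t → good (s, t))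
    (S : Submodule ℂ (ι × ι → ℂ)) (hS : ∀ ψ, ψ ∈ S ↔ ∀ p, ¬ good p → ψ p = 0)
    {φ : ι → ℂ} (hφP : ∀ s, ¬ P₁ s → φ s = 0) (hφ1 : star φ ⬝ᵥ φ = 1) {e₀ : ℝ}
    (hAφ : A *ᵥ φ = (e₀ : ℂ) • φ) :
    (A ⊗ₖ (1 : Matrix ι ι ℂ) + (1 : Matrix ι ι ℂ) ⊗ₖ Aᵀ -
        ((0 : ℝ) : ℂ) • (D ⊗ₖ Dᴴᵀ + Dᴴ ⊗ₖ Dᵀ)).minEnergyOn S ≤ 2 * e₀ := by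
  have htS : (fun p : ι × ι => φ p.1 * (star φ) p.2) ∈ S := by
    refine (hS _).2 fun p hp => ?_
    obtain ⟨s, t⟩ := p
    by_cases hs : P₁ s
    · by_cases ht : P₁ t
      · exact absurd (hgood₁ s t hs ht) hp
      · simp only [Pi.star_apply, hφP t ht, star_zero, mul_zero]
    · simp only [hφP s hs, zero_mul]
  have ht1 : star (fun p : ι × ι => φ p.1 * (star φ) p.2) ⬝ᵥ
      (fun p : ι × ι => φ p.1 * (star φ) p.2) = 1 := by
    rw [star_tensor_conj_dotProduct, hφ1, map_one, Complex.ofReal_one]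
  have h := minEnergyOn_windowDouble_le hA D 0 S htS ht1
  rw [zero_mul, sub_zero, double_mulVec_tensor_conj hA hAφ, dotProduct_smul, ht1, smul_eq_mul,
    mul_one, Complex.ofReal_re] at h
  exact h

end Abstract

section Torus

/-- A normalised ground state of `hubbardTorus 2 L 1 U` in the sector `(2m, S^z = 0)`
(`m ≤ L²`), as a vector of Lieb's `(m, m)` sector. Tasaki (2020) §2.2; Lieb, PRL 62 (1989)
1201. [folklore] -/
theorem exists_unit_szSector_groundState (L : ℕ) [NeZero L] (U : ℝ) {m : ℕ} (hm : m ≤ L ^ 2) :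
    ∃ φ : Fock (Orb (FermionTorus 2 L)), IsInSector m m φ ∧ star φ ⬝ᵥ φ = 1 ∧
      hubbardTorus 2 L 1 U *ᵥ φ =
        (((hubbardTorus 2 L 1 U).minEnergyOn (szSector (2 * m) 0) : ℝ) : ℂ) • φ := by
  have hcard : m ≤ Fintype.card (FermionTorus 2 L) := by rwa [card_fermionTorus]
  obtain ⟨φ, hφmem, hφ0, hHφ⟩ := (szSector_groundState (fermionTorusGraph 2 L) 1 U hcard).1
  obtain ⟨c, -, hc1⟩ := exists_smul_unit hφ0
  refine ⟨c • φ, (mem_szSector_two_mul_zero_iff m _).1 (Submodule.smul_mem _ c hφmem), hc1, ?_⟩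
  have h : hubbardTorus 2 L 1 U *ᵥ φ =
      (((hubbardTorus 2 L 1 U).minEnergyOn (szSector (2 * m) 0) : ℝ) : ℂ) • φ := hHφ
  rw [mulVec_smul, h, smul_comm]

/-- **Reading off one layer.** A unit vector `v` supported in the block `(Nn = 2m, S^z = 0)`
lies in `szSector Nn 0`, and its energy for `H = hubbardTorus 2 L 1 U` is its energy for
`A = H - μ N` plus `μ Nn`: an `A`-excess bound `Re ⟨v, A v⟩ ≤ (e(Nn) - μ Nn) + X` is the
`H`-excess bound `Re ⟨v, H v⟩ ≤ e(Nn) + X`. Tasaki (2020) §2.2. [folklore] -/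
theorem szSector_excess_of_block (L : ℕ) [NeZero L] (U μ X : ℝ) {Nn m : ℕ} (hNm : Nn = 2 * m)
    (v : Fock (Orb (FermionTorus 2 L)))
    (hv : ∀ s, ¬ (s.card = Nn ∧ (s.filter fun o => (ofLex o).2 = 0).card =
        (s.filter fun o => (ofLex o).2 = 1).card) → v s = 0)
    (hv1 : star v ⬝ᵥ v = 1)
    (hvA : (star v ⬝ᵥ hubbardTorusWith 2 L 1 U μ *ᵥ v).re ≤
      (hubbardTorus 2 L 1 U).minEnergyOn (szSector Nn 0) - μ * Nn + X) :
    v ∈ szSector Nn 0 ∧ (star v ⬝ᵥ (hubbardTorus 2 L 1 U *ᵥ v)).re ≤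
      (hubbardTorus 2 L 1 U).minEnergyOn (szSector Nn 0) + X := by
  subst hNm
  have hsec : IsInSector m m v := fun s hs => hv s fun h => hs ((block_iff m s).1 h)
  have hN : IsNParticle (2 * m) v := by
    have := hsec.isNParticle
    rwa [← two_mul] at this
  refine ⟨(mem_szSector_two_mul_zero_iff m v).2 hsec, ?_⟩
  have hA : hubbardTorusWith 2 L 1 U μ *ᵥ v =
      hubbardTorus 2 L 1 U *ᵥ v - ((μ : ℂ) * ((2 * m : ℕ) : ℂ)) • v := by
    rw [hubbardTorusWith_eq, sub_mulVec, smul_mulVec, totalNumber_mulVec_of_isNParticle hN,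
      smul_smul]
  rw [hA, dotProduct_sub, dotProduct_smul, Complex.sub_re, smul_eq_mul, ← Complex.ofReal_natCast,
    ← Complex.ofReal_mul, Complex.re_ofReal_mul, hv1, Complex.one_re, mul_one] at hvA
  linarith

/-- **`HypGivesZEPO`** (stub `stub_hypGivesZEPO_of` of line `Sketch`, crux `JmInterchange`): uniform
linear Josephson gain of the window double gives zero-excess pair order in one layer. Given the
abstract column pigeonhole `hP` and coupling bound `hC`: for `ε > 0` pick
`J = min J₀ (ε a² / (16 C⁶))` (`C L²` the `norm_pairField_le` bound on `‖Δ_d‖`, `M = C² L²` for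
`D = L⁻¹ Δ_d`); for large even `L` the PSD minimiser `ψ_W` of `jmPositiveMinimiser_proof` has
`Re ⟨ψ, K ψ⟩ ≥ a L² = κ` (`sub_le_of_isMinimiser` and the gain) and
`Re ⟨ψ, H₀ ψ⟩ ≤ 2 e₀ + 2 J M` (`couplingExpectBound`, trial state `φ ⊗ φ̄` of a sector ground
state, `e₀ = e(N_L) - μ_L N_L = e(N_L - 2) - μ_L (N_L - 2)`); `A ≥ e₀` on both blocks is
`block_rayleigh_lower`; the column `v` of `windowPigeonhole` lies in `szSector n 0` with
`Re ⟨v, H v⟩ - e(n) ≤ 16 C⁶ J L² / a² ≤ ε L²` and `‖Δ_d v‖² = L² ‖D v‖² ≥ a² L⁴ / (8 C²)`.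
Koma–Tasaki, J. Stat. Phys. 76 (1994) 745; Lieb, PRL 62 (1989) 1201. [folklore] -/
theorem hypGivesZEPO_of_pigeonhole
    (hP : ∀ {ι : Type} [Fintype ι] [DecidableEq ι] (A D W : Matrix ι ι ℂ) (P₁ P₂ : ι → Prop)
      (good : ι × ι → Prop) (e₀ M η κ : ℝ),
      A.IsHermitian → Wᴴ = W → (∀ s, P₁ s → ¬ P₂ s) →
      (∀ s t, good (s, t) → (P₁ s ∧ P₁ t) ∨ (P₂ s ∧ P₂ t)) →
      (∀ s t, ¬ good (s, t) → W s t = 0) →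
      0 < M → 0 ≤ η → 0 < κ →
      (∀ v : ι → ℂ, (∀ s, ¬ P₁ s → v s = 0) → e₀ * (star v ⬝ᵥ v).re ≤ (star v ⬝ᵥ A *ᵥ v).re) →
      (∀ v : ι → ℂ, (∀ s, ¬ P₂ s → v s = 0) → e₀ * (star v ⬝ᵥ v).re ≤ (star v ⬝ᵥ A *ᵥ v).re) →
      (∀ v : ι → ℂ, (star (D *ᵥ v) ⬝ᵥ (D *ᵥ v)).re ≤ M * (star v ⬝ᵥ v).re) →
      (∀ v : ι → ℂ, (star (Dᴴ *ᵥ v) ⬝ᵥ (Dᴴ *ᵥ v)).re ≤ M * (star v ⬝ᵥ v).re) →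
      star (fun p : ι × ι => W p.1 p.2) ⬝ᵥ (fun p : ι × ι => W p.1 p.2) = 1 →
      (star (fun p : ι × ι => W p.1 p.2) ⬝ᵥ
          (A ⊗ₖ (1 : Matrix ι ι ℂ) + (1 : Matrix ι ι ℂ) ⊗ₖ Aᵀ) *ᵥ (fun p : ι × ι => W p.1 p.2)).re ≤
        2 * e₀ + η →
      κ ≤ (star (fun p : ι × ι => W p.1 p.2) ⬝ᵥ
          (D ⊗ₖ Dᴴᵀ + Dᴴ ⊗ₖ Dᵀ) *ᵥ (fun p : ι × ι => W p.1 p.2)).re →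
      ∃ v : ι → ℂ, ((∀ s, ¬ P₁ s → v s = 0) ∨ (∀ s, ¬ P₂ s → v s = 0)) ∧ star v ⬝ᵥ v = 1 ∧
        (star v ⬝ᵥ A *ᵥ v).re ≤ e₀ + 8 * M ^ 2 * η / κ ^ 2 ∧
        κ ^ 2 / (8 * M) ≤ (star (D *ᵥ v) ⬝ᵥ (D *ᵥ v)).re)
    (hC : ∀ {ι : Type} [Fintype ι] [DecidableEq ι] (D : Matrix ι ι ℂ) (M : ℝ) (ψ : ι × ι → ℂ),
      0 ≤ M →
      (∀ v : ι → ℂ, (star (D *ᵥ v) ⬝ᵥ (D *ᵥ v)).re ≤ M * (star v ⬝ᵥ v).re) →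
      (∀ v : ι → ℂ, (star (Dᴴ *ᵥ v) ⬝ᵥ (Dᴴ *ᵥ v)).re ≤ M * (star v ⬝ᵥ v).re) →
      (star ψ ⬝ᵥ (D ⊗ₖ Dᴴᵀ + Dᴴ ⊗ₖ Dᵀ) *ᵥ ψ).re ≤ 2 * M * (star ψ ⬝ᵥ ψ).re) :
    ∀ (U δ a J₀ : ℝ), 0 < U → δ ∈ Set.Ioo (0:ℝ) (1 / 2) → 0 < a → 0 < J₀ →
      (∀ J ∈ Set.Ioc (0:ℝ) J₀, ∃ L₀ : ℕ, ∀ (L : ℕ) [NeZero L], Even L → L₀ ≤ L → (let ι : Type := Finset (Literature.MathematicalPhysics.QuantumLattice.Orb (Literature.MathematicalPhysics.QuantumLattice.FermionTorus 2 L)); let N : ℕ := 2 * ⌊(1 - δ) * (L : ℝ) ^ 2 / 2⌋₊; let H : Matrix ι ι ℂ := Literature.MathematicalPhysics.QuantumLattice.hubbardTorus 2 L 1 U; let μ : ℝ := (H.minEnergyOn (Literature.MathematicalPhysics.QuantumLattice.szSector N 0) - H.minEnergyOn (Literature.MathematicalPhysics.QuantumLattice.szSector (N - 2) 0)) / 2;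 let A : Matrix ι ι ℂ := Literature.MathematicalPhysics.QuantumLattice.hubbardTorusWith 2 L 1 U μ; let D : Matrix ι ι ℂ := ((L : ℂ))⁻¹ • Literature.MathematicalPhysics.QuantumLattice.pairField Literature.MathematicalPhysics.QuantumLattice.dWaveFormFactor L; let Hd : ℝ → Matrix (ι × ι) (ι × ι) ℂ := fun J => Matrix.kroneckerMap (fun a b : ℂ => a * b) A 1 + Matrix.kroneckerMap (fun a b : ℂ => a * b) 1 (Matrix.transpose A) - (J : ℂ) • (Matrix.kroneckerMap (fun a b : ℂ => a * b) D (Matrix.transpose (Matrix.conjTranspose D)) + Matrix.kroneckerMap (fun a b : ℂ => a * b) (Matrix.conjTranspose D) (Matrix.transpose D)); let good : ι × ι → Prop := fun p => ((p.1.card = N ∧ p.2.card = N) ∨ (p.1.card = N - 2 ∧ p.2.card = N - 2)) ∧ (p.1.filter (fun o => (ofLex o).2 = 0)).card = (p.1.filter (fun o => (ofLex o).2 = 1)).card ∧ (p.2.filter (fun o => (ofLex o).2 = 0)).card = (p.2.filter (fun o => (ofLex o).2 = 1)).card; let S : Submodule ℂ (ι × ι → ℂ) := ⨅ (p : ι ×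 ι) (_ : ¬ good p), LinearMap.ker (LinearMap.proj (R := ℂ) (φ := fun _ : ι × ι => ℂ) p); let E : ℝ → ℝ := fun J => (Hd J).minEnergyOn S; a * J * (L : ℝ) ^ 2 ≤ E 0 - E J)) →
      ∃ c : ℝ, 0 < c ∧ ∀ ε : ℝ, 0 < ε → ∃ L₀ : ℕ, ∀ (L : ℕ) [NeZero L], Even L → L₀ ≤ L →
        ∃ n : ℕ, (n = 2 * ⌊(1 - δ) * (L : ℝ) ^ 2 / 2⌋₊ ∨ n = 2 * ⌊(1 - δ) * (L : ℝ) ^ 2 / 2⌋₊ - 2) ∧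
          ∃ v : Fock (Orb (FermionTorus 2 L)), v ∈ szSector n 0 ∧ star v ⬝ᵥ v = 1 ∧
            (star v ⬝ᵥ (hubbardTorus 2 L 1 U *ᵥ v)).re ≤
                (hubbardTorus 2 L 1 U).minEnergyOn (szSector n 0) + ε * (L : ℝ) ^ 2 ∧
            c * (L : ℝ) ^ 4 ≤
              (star (pairField dWaveFormFactor L *ᵥ v) ⬝ᵥ (pairField dWaveFormFactor L *ᵥ v)).re := by
  intro U δ a J₀ _hU hδ ha hJ₀ hG
  -- the a-priori constant `C ≥ 1` with `‖Δ_d‖ ≤ C L²` in every volume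
  obtain ⟨C, hC1, hCΔ⟩ : ∃ C : ℝ, 1 ≤ C ∧ ∀ (L : ℕ) [NeZero L],
      ‖pairField dWaveFormFactor L‖ ≤ C * (L : ℝ) ^ 2 := by
    refine ⟨max 1 (2 * ∑ e ∈ insert (0 : Literature.Probability.LatticeModels.Site 2) unitSteps,
      |dWaveFormFactor e / Real.sqrt 2|), le_max_left _ _,
      fun L _ => (norm_pairField_le dWaveFormFactor L).trans ?_⟩
    exact mul_le_mul_of_nonneg_right (le_max_right _ _) (by positivity)
  have hC0 : 0 < C := by linarith
  refine ⟨a ^ 2 / (8 * C ^ 2), by positivity, fun ε hε => ?_⟩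
  -- the coupling `J = min J₀ (ε a² / (16 C⁶))`
  obtain ⟨J, hJ0, hJJ₀, hJε⟩ : ∃ J : ℝ, 0 < J ∧ J ≤ J₀ ∧ 16 * J * C ^ 6 ≤ ε * a ^ 2 := by
    refine ⟨min J₀ (ε * a ^ 2 / (16 * C ^ 6)), lt_min hJ₀ (by positivity), min_le_left _ _, ?_⟩
    have h := min_le_right J₀ (ε * a ^ 2 / (16 * C ^ 6))
    rw [le_div_iff₀ (by positivity)] at h
    linarith
  obtain ⟨L₀, hL₀⟩ := hG J ⟨hJ0, hJJ₀⟩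
  refine ⟨L₀, fun L _ hE hLL => ?_⟩
  have hgain := hL₀ L hE hLL
  extract_lets ι N H μ A D Hd good S E at hgain
  -- the filling: `N = 2n` with `1 ≤ n ≤ L²`
  set n : ℕ := ⌊(1 - δ) * (L : ℝ) ^ 2 / 2⌋₊ with hn
  have hNn : N = 2 * n := rfl
  have hL2 : (2 : ℝ) ≤ L := by
    have h0 : L ≠ 0 := NeZero.ne L
    obtain ⟨k, hk⟩ := hE
    have : 2 ≤ L := by omega
    exact_mod_cast this
  have hL0 : (0 : ℝ) < L := by linarith
  have hn1 : 1 ≤ n := by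
    rw [hn]
    refine Nat.le_floor ?_
    rw [Nat.cast_one, le_div_iff₀ (by norm_num : (0 : ℝ) < 2)]
    have hδ2 : 1 / 2 ≤ 1 - δ := by linarith [hδ.2]
    nlinarith [hδ2, hL2]
  have hnL : n ≤ L ^ 2 := by
    rw [hn]
    refine Nat.floor_le_of_le ?_
    have hδ0 : 1 - δ ≤ 1 := by linarith [hδ.1]
    have hL0' : (0 : ℝ) ≤ (L : ℝ) ^ 2 := by positivity
    push_cast
    nlinarith
  have hn'L : n - 1 ≤ L ^ 2 := le_trans (Nat.sub_le n 1) hnL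
  have hN2 : N - 2 = 2 * (n - 1) := by omega
  have hN2' : ((N - 2 : ℕ) : ℝ) = (N : ℝ) - 2 := by
    rw [Nat.cast_sub (by omega)]
    norm_num
  -- energies and the balancing chemical potential
  set e₁ : ℝ := H.minEnergyOn (szSector N 0) with he₁
  set e₂ : ℝ := H.minEnergyOn (szSector (N - 2) 0) with he₂
  have hμ : μ = (e₁ - e₂) / 2 := rfl
  set e₀ : ℝ := e₁ - μ * N with he₀
  have he₀₂ : e₀ = e₂ - μ * ((N - 2 : ℕ) : ℝ) := by
    rw [hN2', he₀, hμ]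
    ring
  have hAherm : A.IsHermitian := isHermitian_hamiltonianWith _ 1 U μ
  -- block predicates and the window
  set F : ι → Prop := fun s =>
    (s.filter fun o => (ofLex o).2 = 0).card = (s.filter fun o => (ofLex o).2 = 1).card with hF
  set P₁ : ι → Prop := fun s => s.card = N ∧ F s with hP₁
  set P₂ : ι → Prop := fun s => s.card = N - 2 ∧ F s with hP₂
  have h12 : ∀ s, P₁ s → ¬ P₂ s := by
    rintro s ⟨h1, -⟩ ⟨h2, -⟩
    omega
  have hgood : ∀ s t, good (s, t) → (P₁ s ∧ P₁ t) ∨ (P₂ s ∧ P₂ t) := by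
    rintro s t ⟨h | h, hs, ht⟩
    · exact Or.inl ⟨⟨h.1, hs⟩, ⟨h.2, ht⟩⟩
    · exact Or.inr ⟨⟨h.1, hs⟩, ⟨h.2, ht⟩⟩
  have hgood₁ : ∀ s t, P₁ s → P₁ t → good (s, t) := fun s t hs ht =>
    ⟨Or.inl ⟨hs.1, ht.1⟩, hs.2, ht.2⟩
  have hS : ∀ ψ, ψ ∈ S ↔ ∀ p, ¬ good p → ψ p = 0 := by
    intro ψ
    simp only [S, Submodule.mem_iInf, LinearMap.mem_ker, LinearMap.proj_apply]
  -- Rayleigh floors `A ≥ e₀` on the two blocks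
  have hA₁ : ∀ v : ι → ℂ, (∀ s, ¬ P₁ s → v s = 0) →
      e₀ * (star v ⬝ᵥ v).re ≤ (star v ⬝ᵥ A *ᵥ v).re := by
    intro v hv
    have h := block_rayleigh_lower L U μ hnL v (by simpa [hP₁, hF, hNn] using hv)
    rw [he₀, hNn]
    exact h
  have hA₂ : ∀ v : ι → ℂ, (∀ s, ¬ P₂ s → v s = 0) →
      e₀ * (star v ⬝ᵥ v).re ≤ (star v ⬝ᵥ A *ᵥ v).re := by
    intro v hv
    have h := block_rayleigh_lower L U μ hn'L v (by simpa [hP₂, hF, hN2] using hv)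
    rw [← hN2] at h
    rw [he₀₂]
    exact h
  -- (1) the PSD minimiser of the `J`-problem (reflection positivity of the double)
  obtain ⟨W, V, hWV, hWsupp, hψ1, hψE⟩ :
      ∃ W V : Matrix ι ι ℂ, W = Vᴴ * V ∧ (∀ s t, ¬ good (s, t) → W s t = 0) ∧
        star (fun p : ι × ι => W p.1 p.2) ⬝ᵥ (fun p : ι × ι => W p.1 p.2) = 1 ∧
        (star (fun p : ι × ι => W p.1 p.2) ⬝ᵥ
            (A ⊗ₖ (1 : Matrix ι ι ℂ) + (1 : Matrix ι ι ℂ) ⊗ₖ Aᵀ -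
              (J : ℂ) • (D ⊗ₖ Dᴴᵀ + Dᴴ ⊗ₖ Dᵀ)) *ᵥ (fun p : ι × ι => W p.1 p.2)).re =
          (A ⊗ₖ (1 : Matrix ι ι ℂ) + (1 : Matrix ι ι ℂ) ⊗ₖ Aᵀ -
            (J : ℂ) • (D ⊗ₖ Dᴴᵀ + Dᴴ ⊗ₖ Dᵀ)).minEnergyOn S :=
    jmPositiveMinimiser_proof L U δ J hE hδ hJ0.le
  have hW : Wᴴ = W := by rw [hWV, conjTranspose_mul, conjTranspose_conjTranspose]
  have hψS : (fun p : ι × ι => W p.1 p.2) ∈ S := (hS _).2 fun p hp => hWsupp p.1 p.2 hp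
  -- (2) one-layer bounds `‖D v‖², ‖Dᴴ v‖² ≤ M ‖v‖²` with `M = C² L²` (`D = L⁻¹ Δ_d`)
  obtain ⟨M, hM⟩ : ∃ M : ℝ, M = C ^ 2 * (L : ℝ) ^ 2 := ⟨_, rfl⟩
  have hM0 : 0 < M := by rw [hM]; positivity
  have hDn : ‖D‖ ^ 2 ≤ M := by
    have h1 : ‖D‖ ≤ C * L := by
      show ‖((L : ℂ))⁻¹ • pairField dWaveFormFactor L‖ ≤ C * L
      rw [norm_smul, norm_inv, Complex.norm_natCast, inv_mul_le_iff₀ hL0]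
      calc ‖pairField dWaveFormFactor L‖ ≤ C * (L : ℝ) ^ 2 := hCΔ L
        _ = (L : ℝ) * (C * L) := by ring
    rw [hM]
    calc ‖D‖ ^ 2 ≤ (C * L) ^ 2 := pow_le_pow_left₀ (norm_nonneg _) h1 2
      _ = C ^ 2 * (L : ℝ) ^ 2 := by ring
  have hD : ∀ v : ι → ℂ, (star (D *ᵥ v) ⬝ᵥ (D *ᵥ v)).re ≤ M * (star v ⬝ᵥ v).re := fun v =>
    (re_star_mulVec_self_le_opNorm_sq D v).trans
      (mul_le_mul_of_nonneg_right hDn (Complex.nonneg_iff.1 (dotProduct_star_self_nonneg v)).1)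
  have hDh : ∀ v : ι → ℂ, (star (Dᴴ *ᵥ v) ⬝ᵥ (Dᴴ *ᵥ v)).re ≤ M * (star v ⬝ᵥ v).re := fun v =>
    (re_star_mulVec_self_le_opNorm_sq Dᴴ v).trans
      (mul_le_mul_of_nonneg_right ((Matrix.l2_opNorm_conjTranspose D).symm ▸ hDn)
        (Complex.nonneg_iff.1 (dotProduct_star_self_nonneg v)).1)
  -- (3) the trial state `φ ⊗ φ̄` of a sector-`N_L` ground state: `E(0) ≤ 2 e₀`
  obtain ⟨φ, hφsec, hφ1, hHφ⟩ := exists_unit_szSector_groundState L U hnL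
  have hφP : ∀ s, ¬ P₁ s → φ s = 0 := fun s hs =>
    hφsec s fun h => hs (by simpa [hP₁, hF, hNn] using (block_iff n s).2 h)
  have hφN : IsNParticle N φ := by
    have := hφsec.isNParticle
    rwa [← two_mul] at this
  have hHφ' : H *ᵥ φ = (e₁ : ℂ) • φ := hHφ
  have hAφ : A *ᵥ φ = (e₀ : ℂ) • φ := by
    show hubbardTorusWith 2 L 1 U μ *ᵥ φ = (e₀ : ℂ) • φ
    rw [hubbardTorusWith_eq, sub_mulVec, smul_mulVec, totalNumber_mulVec_of_isNParticle hφN,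
      smul_smul]
    change H *ᵥ φ - _ = _
    rw [hHφ', ← sub_smul, he₀]
    push_cast
    rfl
  have hB := minEnergyOn_zero_le_of_eigen hAherm D P₁ good hgood₁ S hS hφP hφ1 hAφ
  -- (4) the two inputs of the pigeonhole: `Re ⟨ψ, H₀ ψ⟩ ≤ 2e₀ + 2JM`, `a L² ≤ Re ⟨ψ, K ψ⟩`
  have hgain' : a * (L : ℝ) ^ 2 * J ≤
      (A ⊗ₖ (1 : Matrix ι ι ℂ) + (1 : Matrix ι ι ℂ) ⊗ₖ Aᵀ -
          ((0 : ℝ) : ℂ) • (D ⊗ₖ Dᴴᵀ + Dᴴ ⊗ₖ Dᵀ)).minEnergyOn S -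
        (A ⊗ₖ (1 : Matrix ι ι ℂ) + (1 : Matrix ι ι ℂ) ⊗ₖ Aᵀ -
          (J : ℂ) • (D ⊗ₖ Dᴴᵀ + Dᴴ ⊗ₖ Dᵀ)).minEnergyOn S := by
    have h : a * J * (L : ℝ) ^ 2 ≤
        (A ⊗ₖ (1 : Matrix ι ι ℂ) + (1 : Matrix ι ι ℂ) ⊗ₖ Aᵀ -
            ((0 : ℝ) : ℂ) • (D ⊗ₖ Dᴴᵀ + Dᴴ ⊗ₖ Dᵀ)).minEnergyOn S -
          (A ⊗ₖ (1 : Matrix ι ι ℂ) + (1 : Matrix ι ι ℂ) ⊗ₖ Aᵀ -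
            (J : ℂ) • (D ⊗ₖ Dᴴᵀ + Dᴴ ⊗ₖ Dᵀ)).minEnergyOn S := hgain
    linarith
  have hKM := hC D M (fun p : ι × ι => W p.1 p.2) hM0.le hD hDh
  obtain ⟨hH0, hKκ⟩ := pigeonhole_inputs_of_gain hAherm D hJ0 (by positivity : 0 ≤ a * (L : ℝ) ^ 2)
    S hψS hψ1 hψE hgain' hKM hB
  -- (5) the column pigeonhole
  have hκ : 0 < a * (L : ℝ) ^ 2 := by positivity
  have hη : 0 ≤ 2 * J * M := by positivity
  obtain ⟨v, hvP, hv1, hvA, hvD⟩ := hP A D W P₁ P₂ good e₀ M (2 * J * M) (a * (L : ℝ) ^ 2)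
    hAherm hW h12 hgood hWsupp hM0 hη hκ hA₁ hA₂ hD hDh hψ1 hH0 hKκ
  -- (6) the constants: excess `8M²η/κ² = 16 J C⁶ L²/a² ≤ ε L²`, `L² κ²/(8M) = a² L⁴/(8C²)`
  have hexc : 8 * M ^ 2 * (2 * J * M) / (a * (L : ℝ) ^ 2) ^ 2 ≤ ε * (L : ℝ) ^ 2 := by
    rw [div_le_iff₀ (by positivity), hM]
    have hL6 : (0 : ℝ) ≤ (L : ℝ) ^ 6 := by positivity
    calc 8 * (C ^ 2 * (L : ℝ) ^ 2) ^ 2 * (2 * J * (C ^ 2 * (L : ℝ) ^ 2))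
        = 16 * J * C ^ 6 * (L : ℝ) ^ 6 := by ring
      _ ≤ ε * a ^ 2 * (L : ℝ) ^ 6 := mul_le_mul_of_nonneg_right hJε hL6
      _ = ε * (L : ℝ) ^ 2 * (a * (L : ℝ) ^ 2) ^ 2 := by ring
  have hvA' : (star v ⬝ᵥ A *ᵥ v).re ≤ e₀ + ε * (L : ℝ) ^ 2 := hvA.trans (by linarith)
  have hpair : a ^ 2 / (8 * C ^ 2) * (L : ℝ) ^ 4 ≤
      (star (pairField dWaveFormFactor L *ᵥ v) ⬝ᵥ (pairField dWaveFormFactor L *ᵥ v)).re := by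
    have h : (star (D *ᵥ v) ⬝ᵥ (D *ᵥ v)).re =
        ((L : ℝ) ^ 2)⁻¹ * (star (pairField dWaveFormFactor L *ᵥ v) ⬝ᵥ
          (pairField dWaveFormFactor L *ᵥ v)).re := by
      show (star ((((L : ℂ))⁻¹ • pairField dWaveFormFactor L) *ᵥ v) ⬝ᵥ
          ((((L : ℂ))⁻¹ • pairField dWaveFormFactor L) *ᵥ v)).re = _
      rw [re_star_smul_mulVec_dotProduct, norm_inv, Complex.norm_natCast, inv_pow]
    rw [h, le_inv_mul_iff₀ (by positivity), hM] at hvD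
    calc a ^ 2 / (8 * C ^ 2) * (L : ℝ) ^ 4
        = (L : ℝ) ^ 2 * ((a * (L : ℝ) ^ 2) ^ 2 / (8 * (C ^ 2 * (L : ℝ) ^ 2))) := by
          field_simp
      _ ≤ _ := hvD
  -- (7) reading off zero-excess pair order in one layer
  rcases hvP with hv | hv
  · obtain ⟨hmem, hen⟩ := szSector_excess_of_block L U μ (ε * (L : ℝ) ^ 2) hNn v
      (by simpa [hP₁, hF] using hv) hv1 hvA'
    exact ⟨N, Or.inl rfl, v, hmem, hv1, hen, hpair⟩
  · have hvA'' : (star v ⬝ᵥ A *ᵥ v).re ≤ e₂ - μ * ((N - 2 : ℕ) : ℝ) + ε * (L : ℝ) ^ 2 := by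
      rw [← he₀₂]
      exact hvA'
    obtain ⟨hmem, hen⟩ := szSector_excess_of_block L U μ (ε * (L : ℝ) ^ 2) hN2 v
      (by simpa [hP₂, hF] using hv) hv1 hvA''
    exact ⟨N - 2, Or.inr rfl, v, hmem, hv1, hen, hpair⟩

end Torus

end Summit.HubbardSuperconductivity.HubbardSuperconductivity.Theorems.JosephsonMirror
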